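import Literature.NumberTheory.Sieve.ChenSiftedLower
import HarnessLib

/-!
# Chen's Theorem I: the lower bound for `S(A, 𝒫, x^{1/10})` (Chen 1973, Lemma 9, first half)

Companion of `ChenTheoremIAssembly.lean`, which assembles Chen's Theorem I
(`P_x(1,2) ≥ 0.67 x C_x/(log x)²`, Sci. Sinica 16 (1973)) from three sieve estimates at Chen's
sieving level `z = x^{1/10}`. This file PROVES hypothesis (A) of
`Literature.NumberTheory.Sieve.Chen.Chen1973_theoremI_of`, with the constant `a = f(5)`:

* `siftedCount_tenth_lower` — for every `ε > 0` and all large even `x`,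
  `S(A, 𝒫, x^{1/10}) ≥ (f(5) − ε) · x V(x^{1/10})/log x`,
  where `A = {x − p : p ≤ x prime, p ∤ x}`, `V(z) = ∏_{p < z, p ∤ x} (1 − 1/(p−1))` and
  `f = lowerSieveFun 1` is the lower function of the linear sieve (`f(5) = 0.99824…`; the value is
  not needed here — Chen's (30)–(31): `5 f(5) = 2e^γ (log 4 + ∫₃⁴ (du/u) ∫₂^{u−1} log(t−1) dt/t)`).

This is Chen's (31) (PDF p. 168 of the held copy: Richert's Theorem A with `ξ² = x^{1/2−ε}`, `q = 1`,
`z = x^{1/10}`, remainders by Bombieri's theorem), in the form of Nathanson's Theorem 10.4 moved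
from `N^{1/8}` (`s = 4`) to `N^{1/10}` (`s = 5`). The proof is that of
`Literature.NumberTheory.Sieve.Chen.chen_sifted_lower_holds` (`ChenSiftedLower.lean`), with the same
PROVED inputs: Iwaniec's linear sieve, uniform in the sequence
(`Iwaniec1980_thm1_lower_of_half_lt`, `κ = 1`, lower function `lowerSieveFun 1`), the
Bombieri–Vinogradov theorem in `π`-form (`eventually_sum_abs_primeCountingDisc_le`, level
`x^{1/2−δ}`, so `s = 5 − 10δ`; the continuity of `f` at `5` absorbs the `δ`), the prime number
theorem (`eventually_primeCounting_bounds`) and the dimension condition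
`hasIwaniecDimension_chenGoldbachSeq`. No numerical information about `f(5)` is used (not even
its sign: the size `X = π(x)` is compared with `x/log x` through `|X − x/log x| ≤ η x/log x`).

## References

* Chen Jing-run, Sci. Sinica 16 (1973) 157–176, Lemma 9, (29)–(31) (PDF pp. 167–168 of the held
  copy). [ChenSciSinica1973]
* M. B. Nathanson, *Additive Number Theory: The Classical Bases*, GTM 164 (1996), Thm 10.4.
  [Nathanson1996]
* H. Iwaniec, *Rosser's sieve*, Acta Arith. 36 (1980), 171–202, Theorem 1. [IwaniecActaArith1980]
-/

open Finset Filter Topology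

noncomputable section

namespace Literature.NumberTheory.Sieve.Chen

open SieveSequence

set_option maxHeartbeats 800000 in
/-- **Chen's Lemma 9, first half (hypothesis (A) of `Chen1973_theoremI_of`), PROVED**: for every
`ε > 0` and all large even `x`, `S(A, 𝒫, x^{1/10}) ≥ (f(5) − ε) x V(x^{1/10})/log x` with
`f = lowerSieveFun 1`. Proof: the linear sieve lower bound (Iwaniec's Theorem 1 at `κ = 1`,
uniform in the sequence) for `chenGoldbachSeq x` at level `D = x^{1/2−δ}` and `z = x^{1/10}`
(`s = 5 − 10δ`, `|f(s) − f(5)| ≤ ε/4` by continuity), the remainder controlled by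
Bombieri–Vinogradov in `π`-form (`R ≤ C x/(log x)⁴ + x^{1/2−δ} ω(x) = o(x V/log x)` as
`V ≫ 1/log x`), and `X = π(x) = (1 + O(η)) x/log x` (prime number theorem).
[cite: ChenSciSinica1973, Lemma 9 (31)] -/
theorem siftedCount_tenth_lower {ε : ℝ} (hε : 0 < ε) :
    ∃ x₀ : ℕ, ∀ x : ℕ, x₀ ≤ x → Even x →
      (lowerSieveFun 1 5 - ε) *
          ((x : ℝ) * sieveProduct x ((x : ℝ) ^ (1 / 10 : ℝ)) / Real.log x) ≤
        siftedCount x ((x : ℝ) ^ (1 / 10 : ℝ)) := by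
  set a := lowerSieveFun 1 5 with ha
  -- the working accuracy `ε' = min ε 1`
  set ε' := min ε 1 with hε'
  have hε'0 : 0 < ε' := lt_min hε one_pos
  have hε'ε : ε' ≤ ε := min_le_left _ _
  have hε'1 : ε' ≤ 1 := min_le_right _ _
  -- continuity of `f = lowerSieveFun 1` at `5`
  have hcont : ContinuousAt (lowerSieveFun 1) 5 :=
    (isBetaSieveSolution_upperSieveFun_one.continuousOn_lower).continuousAt
      (Ioi_mem_nhds (by norm_num : (0 : ℝ) < 5))
  obtain ⟨ρ, hρ0, hρ⟩ := Metric.continuousAt_iff.mp hcont (ε' / 4) (by positivity)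
  -- parameters: level `x^{1/2 − δ}`, `s = 5 − 10δ`, PNT accuracy `η`
  set δ := min (1 / 20) (ρ / 20) with hδ
  have hδ0 : 0 < δ := by positivity
  have hδ1 : δ ≤ 1 / 20 := min_le_left _ _
  have hδρ : δ ≤ ρ / 20 := min_le_right _ _
  set θ₁ := 1 / 2 - δ with hθ₁
  have hθ₁lt : θ₁ < 1 / 2 := by rw [hθ₁]; linarith
  have hθ₁pos : 0 < θ₁ := by rw [hθ₁]; linarith
  have hfs : |lowerSieveFun 1 (5 - 10 * δ) - a| < ε' / 4 := by
    have hd : dist (5 - 10 * δ) (5 : ℝ) < ρ := by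
      rw [Real.dist_eq, show (5 : ℝ) - 10 * δ - 5 = -(10 * δ) by ring, abs_neg,
        abs_of_pos (by positivity)]
      linarith
    have h := hρ hd
    rwa [Real.dist_eq] at h
  set η := ε' / (16 * (|a| + 1)) with hη
  have hη0 : 0 < η := by positivity
  -- the linear sieve (Iwaniec's Theorem 1, `κ = 1`) and its constant for `Ω(1, L₀)`
  obtain ⟨B, hB, hBC⟩ := Iwaniec1980_thm1_lower_of_half_lt (κ := 1) (by norm_num)
  obtain ⟨C, hC⟩ := hBC dimConst
  have hfeq : Set.EqOn B.2.1 (iwaniecLowerSieveFun 1) (Set.Ioi 0) := hB.eqOn_iwaniecSieveFun.2.1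
  -- Bombieri–Vinogradov (`π`-form, level `x^{θ₁}`)
  obtain ⟨C₁, hC₁⟩ := eventually_sum_abs_primeCountingDisc_le BombieriVinogradovStatement_holds
    hθ₁lt (A := 4) (by norm_num)
  -- the constant of `V(z)⁻¹ ≤ κ₀ log x`
  have hlog2 : 0 < Real.log 2 := Real.log_pos one_lt_two
  have hdim0 : 0 ≤ dimConst := by rw [dimConst]; positivity
  set κ₀ := (1 + dimConst / Real.log 2) / (10 * Real.log 2) with hκ₀
  have hκ₀0 : 0 < κ₀ := by positivity
  -- eventualities
  have hE1 := eventually_primeCounting_bounds hη0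
  have hE2 : ∀ᶠ N : ℕ in atTop, |C| * (θ₁ * Real.log N) ^ (-(1 / 3 : ℝ)) ≤ ε' / 16 := by
    have ht : Tendsto (fun x : ℝ => |C| * (θ₁ * Real.log x) ^ (-(1 / 3 : ℝ))) atTop
        (𝓝 (|C| * 0)) :=
      ((tendsto_rpow_neg_atTop (by norm_num : (0 : ℝ) < 1 / 3)).comp
        (Real.tendsto_log_atTop.const_mul_atTop hθ₁pos)).const_mul _
    rw [mul_zero] at ht
    exact tendsto_natCast_atTop_atTop.eventually (ht.eventually_le_const (by positivity))
  have hE3 : ∀ᶠ N : ℕ in atTop, 16 * κ₀ * max C₁ 0 ≤ ε' * Real.log N ^ 2 := by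
    have ht : Tendsto (fun x : ℝ => ε' * Real.log x ^ 2) atTop atTop :=
      ((tendsto_pow_atTop two_ne_zero).comp Real.tendsto_log_atTop).const_mul_atTop hε'0
    exact tendsto_natCast_atTop_atTop.eventually (ht.eventually_ge_atTop _)
  have hE4 : ∀ᶠ N : ℕ in atTop,
      Real.log (N : ℝ) ^ 3 ≤ ε' * Real.log 2 / (16 * κ₀) * (N : ℝ) ^ (1 - θ₁) := by
    have hlo := (isLittleO_log_rpow_rpow_atTop 3 (show (0 : ℝ) < 1 - θ₁ by linarith)).def
      (show 0 < ε' * Real.log 2 / (16 * κ₀) by positivity)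
    filter_upwards [tendsto_natCast_atTop_atTop.eventually hlo, eventually_ge_atTop 1] with N hN hN1
    have hN0 : (0 : ℝ) ≤ N := Nat.cast_nonneg N
    rw [Real.norm_of_nonneg (by positivity), Real.norm_of_nonneg (Real.rpow_nonneg hN0 _)] at hN
    have e3 : Real.log (N : ℝ) ^ (3 : ℝ) = Real.log N ^ 3 := by
      rw [show (3 : ℝ) = ((3 : ℕ) : ℝ) by norm_num, Real.rpow_natCast]
    rwa [e3] at hN
  obtain ⟨N₀, hN₀⟩ := Filter.eventually_atTop.mp
    ((eventually_ge_atTop 1024).and (hE1.and (hC₁.and (hE2.and (hE3.and hE4)))))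
  refine ⟨N₀, fun N hN hEven => ?_⟩
  obtain ⟨h1024, hPNT, hBVN, h2, h3, h4⟩ := hN₀ N hN
  -- basic facts about `N`
  have hN0 : N ≠ 0 := by omega
  have hN1 : (1 : ℝ) < N := by exact_mod_cast (show 1 < N by omega)
  have hNpos : (0 : ℝ) < N := by linarith
  set L := Real.log N with hL
  have hL0 : 0 < L := Real.log_pos hN1
  -- the sieve parameters `z = N^{1/10}`, `D = N^{1/2 - δ}`, `s = log D/log z = 5 - 10δ`
  set zN := (N : ℝ) ^ (1 / 10 : ℝ) with hzN
  set D := (N : ℝ) ^ θ₁ with hD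
  have hz2 : 2 ≤ zN := by
    rw [hzN, show (2 : ℝ) = ((2 : ℝ) ^ (10 : ℕ)) ^ (1 / 10 : ℝ) by
      rw [← Real.rpow_natCast, ← Real.rpow_mul (by norm_num)]; norm_num]
    exact Real.rpow_le_rpow (by norm_num) (by norm_num; exact_mod_cast h1024) (by norm_num)
  have hlogz : Real.log zN = 1 / 10 * L := by rw [hzN, Real.log_rpow hNpos]
  have hlogD : Real.log D = θ₁ * L := by rw [hD, Real.log_rpow hNpos]
  have hzD : zN ≤ D := by
    rw [hzN, hD]
    exact Real.rpow_le_rpow_of_exponent_le hN1.le (by rw [hθ₁]; linarith)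
  have hD0 : 0 ≤ D := Real.rpow_nonneg hNpos.le _
  have hs : Real.log D / Real.log zN = 5 - 10 * δ := by
    rw [hlogz, hlogD, hθ₁]; field_simp; ring
  -- the sieve theorem for `chenGoldbachSeq N` at `x = N`, `y = D`, `z = N^{1/10}`
  have hdim := hasIwaniecDimension_chenGoldbachSeq hEven
  have hmain := hC (chenGoldbachSeq N) hdim N D zN hz2 hzD
    (show (0 : ℝ) ≤ (Nat.primeCounting N : ℝ) from Nat.cast_nonneg _)
  have hsize : (chenGoldbachSeq N).size N = (Nat.primeCounting N : ℝ) := rfl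
  have hfval : B.2.1 (5 - 10 * δ) = lowerSieveFun 1 (5 - 10 * δ) := by
    rw [hfeq (show (0 : ℝ) < 5 - 10 * δ by linarith), ← lowerSieveFun_one]
  rw [sifted_chenGoldbachSeq, densityProduct_chenGoldbachSeq, hs, hsize, hfval] at hmain
  -- names
  set V := sieveProduct N zN with hV
  set X := (Nat.primeCounting N : ℝ) with hX
  set R := ∑ d ∈ (range ⌈D⌉₊).filter (· ∣ primesProdBelow zN), |(chenGoldbachSeq N).remainder d N|
    with hR
  set S := (siftedCount N zN : ℝ) with hS
  set M := (N : ℝ) * V / L with hM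
  set c' := lowerSieveFun 1 (5 - 10 * δ) - C * Real.log D ^ (-(1 / 3 : ℝ)) with hc'
  have hVI : 0 ≤ V ∧ V ≤ 1 := sieveProduct_mem_Icc hEven zN
  -- (0) `V ≥ 1/(κ₀ L)`, hence `M ≥ N/(κ₀ L²) > 0`
  have hVpos : 0 < V := by
    rw [hV, ← densityProduct_chenGoldbachSeq]; exact hdim.densityProduct_pos zN
  have hVinv : V⁻¹ ≤ κ₀ * L := by
    have h := hdim.inv_densityProduct_le hz2
    rw [densityProduct_chenGoldbachSeq, Real.rpow_one, hlogz] at h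
    refine h.trans (le_of_eq ?_)
    rw [hκ₀]; field_simp
  have hMpos : 0 < M := by positivity
  have hKM : (N : ℝ) / (κ₀ * L ^ 2) ≤ M := by
    have h1 : (κ₀ * L)⁻¹ ≤ V := by rw [inv_le_comm₀ (by positivity) hVpos]; exact hVinv
    calc (N : ℝ) / (κ₀ * L ^ 2) = (N : ℝ) / L * (κ₀ * L)⁻¹ := by field_simp
      _ ≤ (N : ℝ) / L * V := mul_le_mul_of_nonneg_left h1 (by positivity)
      _ = M := by rw [hM]; ring
  -- (1) the coefficient: `|c' - a| ≤ 5ε'/16`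
  have herr1 : |C| * Real.log D ^ (-(1 / 3 : ℝ)) ≤ ε' / 16 := by rw [hlogD]; exact h2
  have hCabs : |C * Real.log D ^ (-(1 / 3 : ℝ))| ≤ ε' / 16 := by
    rw [abs_mul, abs_of_nonneg (Real.rpow_nonneg (by rw [hlogD]; positivity) _)]
    exact herr1
  have hclow : a - 5 * ε' / 16 ≤ c' := by
    rw [hc']
    have := (abs_lt.mp hfs).1
    have := (abs_le.mp hCabs).2
    linarith
  have hcabs : |c'| ≤ |a| + 1 := by
    rw [hc']
    calc |lowerSieveFun 1 (5 - 10 * δ) - C * Real.log D ^ (-(1 / 3 : ℝ))|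
        = |a + (lowerSieveFun 1 (5 - 10 * δ) - a) - C * Real.log D ^ (-(1 / 3 : ℝ))| := by ring_nf
      _ ≤ |a + (lowerSieveFun 1 (5 - 10 * δ) - a)| + |C * Real.log D ^ (-(1 / 3 : ℝ))| :=
          abs_sub _ _
      _ ≤ |a| + |lowerSieveFun 1 (5 - 10 * δ) - a| + |C * Real.log D ^ (-(1 / 3 : ℝ))| := by
          gcongr; exact abs_add_le _ _
      _ ≤ |a| + ε' / 4 + ε' / 16 := by gcongr
      _ ≤ |a| + 1 := by linarith
  -- (2) the main term: `X V c' ≥ (a - 6ε'/16) M` (PNT: `|X - N/L| ≤ η N/L`, `η (|a|+1) = ε'/16`)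
  have hXlow : (1 - η) * ((N : ℝ) / L) ≤ X := hPNT.1
  have hXup : X ≤ (1 + η) * ((N : ℝ) / L) := hPNT.2
  have hXdiff : |X - (N : ℝ) / L| ≤ η * ((N : ℝ) / L) := by
    rw [abs_le]; constructor <;> nlinarith
  have hmainTerm : (a - 6 * ε' / 16) * M ≤ X * V * c' := by
    have hηa : η * (|a| + 1) = ε' / 16 := by rw [hη]; field_simp
    have hNL : 0 ≤ (N : ℝ) / L * V := by positivity
    have h1 : (N : ℝ) / L * V * (a - 5 * ε' / 16) ≤ (N : ℝ) / L * V * c' :=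
      mul_le_mul_of_nonneg_left hclow hNL
    have h2 : |(X - (N : ℝ) / L) * V * c'| ≤ η * ((N : ℝ) / L) * V * (|a| + 1) := by
      rw [abs_mul, abs_mul, abs_of_nonneg hVI.1]
      have := mul_le_mul (mul_le_mul_of_nonneg_right hXdiff hVI.1) hcabs (abs_nonneg _)
        (by positivity)
      linarith
    have h3 := neg_abs_le ((X - (N : ℝ) / L) * V * c')
    calc (a - 6 * ε' / 16) * M
        = (N : ℝ) / L * V * (a - 5 * ε' / 16) - η * ((N : ℝ) / L) * V * (|a| + 1) := by
          rw [hM, show η * ((N : ℝ) / L) * V * (|a| + 1) = η * (|a| + 1) * ((N : ℝ) / L * V) by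
            ring, hηa]; ring
      _ ≤ (N : ℝ) / L * V * c' + (X - (N : ℝ) / L) * V * c' := by linarith
      _ = X * V * c' := by ring
  -- (3) the remainder: `R ≤ C₁ N/L⁴ + D L/log 2 ≤ (ε'/8) M`
  have hω : (N.primeFactors.card : ℝ) ≤ L / Real.log 2 := card_primeFactors_le_log_div hN0
  have hRle : R ≤ C₁ * N / L ^ 4 + D * (L / Real.log 2) := by
    refine (remainderSum_chenGoldbachSeq_le hN0 zN hD0).trans ?_
    have hb := hBVN (resUnit N)
    rw [show (4 : ℝ) = ((4 : ℕ) : ℝ) by norm_num, Real.rpow_natCast] at hb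
    exact add_le_add hb (mul_le_mul_of_nonneg_left hω hD0)
  have hR1 : C₁ * N / L ^ 4 ≤ ε' / 16 * M := by
    have h3' : 16 * κ₀ * max C₁ 0 ≤ ε' * L ^ 2 := h3
    calc C₁ * N / L ^ 4 ≤ max C₁ 0 * N / L ^ 4 := by
          rw [mul_div_assoc, mul_div_assoc]
          exact mul_le_mul_of_nonneg_right (le_max_left _ _) (by positivity)
      _ = (16 * κ₀ * max C₁ 0) * (N / (16 * κ₀ * L ^ 4)) := by field_simp
      _ ≤ (ε' * L ^ 2) * (N / (16 * κ₀ * L ^ 4)) := mul_le_mul_of_nonneg_right h3' (by positivity)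
      _ = ε' / 16 * (N / (κ₀ * L ^ 2)) := by field_simp
      _ ≤ ε' / 16 * M := mul_le_mul_of_nonneg_left hKM (by positivity)
  have hR2 : D * (L / Real.log 2) ≤ ε' / 16 * M := by
    have hsplit : (N : ℝ) = D * (N : ℝ) ^ (1 - θ₁) := by
      rw [hD, ← Real.rpow_add hNpos, show θ₁ + (1 - θ₁) = 1 by ring, Real.rpow_one]
    calc D * (L / Real.log 2) = D * L ^ 3 / (Real.log 2 * L ^ 2) := by field_simp
      _ ≤ D * (ε' * Real.log 2 / (16 * κ₀) * (N : ℝ) ^ (1 - θ₁)) / (Real.log 2 * L ^ 2) := by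
          gcongr
      _ = ε' / 16 * ((D * (N : ℝ) ^ (1 - θ₁)) / (κ₀ * L ^ 2)) := by field_simp
      _ = ε' / 16 * (N / (κ₀ * L ^ 2)) := by rw [← hsplit]
      _ ≤ ε' / 16 * M := mul_le_mul_of_nonneg_left hKM (by positivity)
  -- (4) combine: `S ≥ (a - 8ε'/16) M ≥ (a - ε) M`
  have hSge : (a - 8 * ε' / 16) * M ≤ S := by
    have e : (a - 8 * ε' / 16) * M = (a - 6 * ε' / 16) * M - (ε' / 16 * M + ε' / 16 * M) := by ring
    have hm : X * V * c' - R ≤ S := hmain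
    linarith [hmainTerm, hRle, hR1, hR2]
  show (a - ε) * M ≤ S
  have h5 : (a - ε) * M ≤ (a - 8 * ε' / 16) * M := mul_le_mul_of_nonneg_right (by linarith) hMpos.le
  linarith

end Literature.NumberTheory.Sieve.Chen
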